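import Literature.AlgebraicGeometry.Modules.LineBundleOfCocycle
import Literature.AlgebraicGeometry.Modules.IsoOfFrames
import HarnessLib

/-!
# [OURS · L1 W4.5(b) · EL♮(3)] T-DIRLIFT-UP, route C, brick C1a — THE SUB-LINE-BUNDLE OF A TWISTED FAMILY OF SECTIONS: a family
# `w_x ∈ Γ(E, U_x)` with `w_y = g_{xy} · w_x` defines `ι : L_g ⟶ E` from the cocycle line bundle, locally split as soon as some functional
# takes the value `1` on `w_x`

Crux chain w45b (cell `res-hironaka`, slot W4.5(b)), working crux **EL♮** = stmt-ResolutionOfSingularities-20038, child **EL♮(3)** =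
stmt-ResolutionOfSingularities-20148, route EquisingularLift, line `sections`; object **T-DIRLIFT-UP** (the P1VB glue of a direction round,
res-L1-w45b-plan-1 RULINGS 19:13:00Z / 19:14:55Z: ROUTE C; spec `L/res-D-pv-051/TARGET-DIRLIFT.sig.md` 7aab4520d07b2a47, entry text
`TARGET-DIRLIFT-UP.sig.lean` 79182c5cfea32e6c), brick **C1a** = the module-theoretic half of C1 «direction ↦ (L₀, ι₀, hsplit)»: with the unit
cocycle `ū` of the direction line (C1 ring core p561783 `exists_unit_of_coords_eq`) and the direction generators `w_x = ᾱ_x ℓ̄_x + β̄_x m̄_x` in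
the pulled-back conormal frames, this file produces T-P1VB's inputs `L₀ := UnitCocycle.lineBundle`, `ι₀ : L₀ ⟶ g^*F` and `hsplit`
(unimodularity `x ᾱ + y β̄ = 1` gives the functional). HONEST FRAMING: OURS; NOT a statement of any manuscript; AI-written, weaker than
expert review. No `sorry`; standard axioms. DEF-FREE. `--supports stmt-ResolutionOfSingularities-20148 --as helper`.

WHAT (namespace `…Cruxes.EquisingularLiftNat.P1VB`; any scheme `X`, any `𝒪_X`-module `E`, any point-indexed unit cocycle `c`).
* `localHom c w x := c.lineBundleTrivInv x ≫ smulSection (w x)` is written inline (no def): `s ↦ s_x · w_x`.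
* `restrictHom_localHom_eq` — the local morphisms of a `c`-TWISTED family (`w_y| = g_{xy} • w_x|`) agree on overlaps.
* **`exists_hom_lineBundle_of_twisted`** — they glue (Literature `Modules/SheafHom.glueHom` + `homOfTop`) to `ι : lineBundle c ⟶ E` whose
  restriction to every `U_x` is the local morphism.
* `smulSection_comp_eq_id_of_eval_one` — if a functional `ρ : E|_U → 𝒪|_U` has `ρ(w) = 1` then `(r ↦ r•w) ≫ ρ = 𝟙`.
* **`exists_retraction_of_eval_one`** — hence such an `ι` is SPLIT over `U_x` by `ρ ≫ lineBundleTriv`: T-P1VB's `hsplit` shape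
  `(overFunctor (U x)).map ι ≫ r = 𝟙`.
* `exists_functional_of_unimodular_coords` — in a frame `e : 𝒪^I ≅ E|_U`, if `Σ r_i · coord_i(w) = 1` then `ρ := Σ r_i • λ_i` has `ρ(w) = 1`.

References: R. Hartshorne, *Algebraic Geometry* (1977), II Ex. 1.22, II §5; The Stacks Project, Tag 00AK — through the tree
(Literature `Modules/LineBundleOfCocycle`, `Modules/SheafHom` (`glueHom`, `appLE`), `Modules/LocalFrames` (`smulSection`, `dualBasis`, `coord`),
`Modules/IsoOfFrames` (`homOfTop`)).
-/

noncomputable section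

open CategoryTheory AlgebraicGeometry Opposite TopologicalSpace
open Literature.AlgebraicGeometry.Modules Literature.AlgebraicGeometry.Motives

set_option linter.dupNamespace false -- mandated namespace `Summit.<Summit>.<Problem>` of this single-conjunct summit

namespace Summit.ResolutionOfSingularities.ResolutionOfSingularities.Cruxes.EquisingularLiftNat.P1VB

universe u

variable {X : Scheme.{u}} (c : UnitCocycle X) {E : X.Modules}

/-! ## 1. The local morphisms of a twisted family agree on overlaps -/

/-- Values of the local morphism `s ↦ s_x · w_x|`. [folklore] -/
theorem appLE_localHom (w : ∀ x, Γ(E, c.U x)) (x : X) {W : X.Opens} (k : W ⟶ c.U x) (s : Γ(lineBundle c, W)) :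
    appLE (c.lineBundleTrivInv x ≫ smulSection (w x)) k s =
      secRes X (le_inf le_rfl k.le) (c.comp s x) • E.presheaf.map k.op (w x) := by
  rw [appLE_comp, UnitCocycle.appLE_lineBundleTrivInv, appLE_smulSection]

/-- **The local morphisms of a twisted family agree on overlaps.** For sections `w_x ∈ Γ(E, U_x)` with `w_y| = g_{xy} · w_x|` below
`U_x ⊓ U_y` (twisted by the cocycle, in the convention `t_y = g_{xy} t_x` of the generators of `c.lineBundle`), the morphisms
`(c.lineBundle)|_{U_x} → E|_{U_x}`, `s ↦ s_x · w_x`, coincide below `U_x ⊓ U_y`. [cite: Hartshorne1977, II Ex. 1.22] -/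
theorem restrictHom_localHom_eq (w : ∀ x, Γ(E, c.U x))
    (hw : ∀ (x y : X) (V : X.Opens) (hx : V ≤ c.U x) (hy : V ≤ c.U y),
      E.presheaf.map (homOfLE hy).op (w y) = c.g x y V hx hy • E.presheaf.map (homOfLE hx).op (w x))
    (x y : X) :
    restrictHom (Opens.infLELeft (c.U x) (c.U y)) (c.lineBundleTrivInv x ≫ smulSection (w x)) =
      restrictHom (Opens.infLERight (c.U x) (c.U y)) (c.lineBundleTrivInv y ≫ smulSection (w y)) := by
  refine hom_ext_of_appLE fun W k s => ?_
  rw [appLE_restrictHom, appLE_restrictHom, appLE_localHom, appLE_localHom]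
  have hxW : W ≤ c.U x := k.le.trans inf_le_left
  have hyW : W ≤ c.U y := k.le.trans inf_le_right
  have hkx : (k ≫ Opens.infLELeft (c.U x) (c.U y)) = homOfLE hxW := Subsingleton.elim _ _
  have hky : (k ≫ Opens.infLERight (c.U x) (c.U y)) = homOfLE hyW := Subsingleton.elim _ _
  rw [hkx, hky, hw x y W hxW hyW, ← mul_smul]
  congr 1
  -- `s_x = g_{xy} s_y` on `W` (the glue relation of the section `s`)
  have hrel := c.comp_rel s x y W le_rfl hxW hyW
  rw [hrel, mul_comm]

/-! ## 2. Gluing the local morphisms -/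

/-- The cover `(U_x)` of a point-indexed cocycle is a cover: `⨆ U_x = ⊤`. [folklore] -/
theorem iSup_U_eq_top : iSup c.U = ⊤ :=
  top_le_iff.mp fun x _ => Opens.mem_iSup.mpr ⟨x, c.mem x⟩

/-- **The sub-line-bundle of a twisted family of sections.** A `c`-twisted family `w_x ∈ Γ(E, U_x)` defines a morphism
`ι : lineBundle c ⟶ E` with `ι|_{U_x} = (s ↦ s_x · w_x)` for every `x` (the local morphisms glued; `ι(t_x) = w_x`).
[cite: Hartshorne1977, II Ex. 1.22] [cite: StacksProject, Tag 00AK] -/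
theorem exists_hom_lineBundle_of_twisted (w : ∀ x, Γ(E, c.U x))
    (hw : ∀ (x y : X) (V : X.Opens) (hx : V ≤ c.U x) (hy : V ≤ c.U y),
      E.presheaf.map (homOfLE hy).op (w y) = c.g x y V hx hy • E.presheaf.map (homOfLE hx).op (w x)) :
    ∃ ι : lineBundle c ⟶ E,
      ∀ x, (SheafOfModules.overFunctor _ (c.U x)).map ι = c.lineBundleTrivInv x ≫ smulSection (w x) := by
  set sf : ∀ x, (lineBundle c).over (c.U x) ⟶ E.over (c.U x) := fun x => c.lineBundleTrivInv x ≫ smulSection (w x) with hsf_def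
  have hsf : ∀ x y, restrictHom (Opens.infLELeft (c.U x) (c.U y)) (sf x) =
      restrictHom (Opens.infLERight (c.U x) (c.U y)) (sf y) := restrictHom_localHom_eq c w hw
  have hU : iSup c.U = ⊤ := iSup_U_eq_top c
  refine ⟨homOfTop (restrictHom (homOfLE hU.ge) (glueHom c.U sf hsf)), fun x => ?_⟩
  refine hom_ext_of_appLE fun W k s => ?_
  rw [appLE_over_map, homOfTop_app, appLE_restrictHom, appLE_glueHom]
  exact glueValue_eq_appLE c.U sf hsf x k _ s

/-! ## 3. Local splitting from a functional with `ρ(w) = 1` -/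

/-- If a functional `ρ : E|_U → 𝒪|_U` takes the value `1` on `w ∈ Γ(E, U)`, then `(r ↦ r • w) ≫ ρ = 𝟙`. [folklore] -/
theorem smulSection_comp_eq_id_of_eval_one {U : X.Opens} (w : Γ(E, U)) (ρ : E.over U ⟶ (unitModule X).over U)
    (hρ : @Eq Γ(X, U) (appLE ρ (𝟙 U) w) 1) : smulSection w ≫ ρ = 𝟙 _ := by
  refine hom_ext_of_appLE fun W k (r : Γ(X, W)) => ?_
  rw [appLE_comp, appLE_smulSection, appLE_smul_right, appLE_id]
  have h := appLE_map ρ (𝟙 U) k w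
  rw [Category.comp_id] at h
  have h1 : @Eq Γ(X, W) (appLE ρ k (E.presheaf.map k.op w)) 1 := by
    have h' : @Eq Γ(X, W) (appLE ρ k (E.presheaf.map k.op w)) (X.presheaf.map k.op (appLE ρ (𝟙 U) w : Γ(X, U))) := h
    rw [h', hρ, map_one]
  have h2 : ∀ z : Γ(X, W), @Eq Γ(X, W) (appLE ρ k (E.presheaf.map k.op w)) z →
      (r • appLE ρ k (E.presheaf.map k.op w) : Γ(unitModule X, W)) = r * z := by
    intro z hz; rw [← hz]; rfl
  rw [h2 1 h1, mul_one]

/-- **Local splitting.** If `ι : lineBundle c ⟶ E` restricts over `U_x` to `s ↦ s_x · w_x` and some functional `ρ : E|_{U_x} → 𝒪|_{U_x}`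
has `ρ(w_x) = 1`, then `ι` is SPLIT over `U_x`: `ι|_{U_x} ≫ (ρ ≫ triv_x) = 𝟙` — T-P1VB's `hsplit` shape. [cite: Hartshorne1977, II Ex. 5.1] -/
theorem exists_retraction_of_eval_one (w : ∀ x, Γ(E, c.U x)) (ι : lineBundle c ⟶ E) (x : X)
    (hι : (SheafOfModules.overFunctor _ (c.U x)).map ι = c.lineBundleTrivInv x ≫ smulSection (w x))
    (ρ : E.over (c.U x) ⟶ (unitModule X).over (c.U x)) (hρ : @Eq Γ(X, c.U x) (appLE ρ (𝟙 (c.U x)) (w x)) 1) :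
    ∃ r : E.over (c.U x) ⟶ (lineBundle c).over (c.U x), (SheafOfModules.overFunctor _ (c.U x)).map ι ≫ r = 𝟙 _ := by
  refine ⟨ρ ≫ (c.lineBundleTriv x).hom, ?_⟩
  rw [hι, Category.assoc, ← Category.assoc (smulSection (w x)), smulSection_comp_eq_id_of_eval_one (w x) ρ hρ,
    Category.id_comp]
  exact (c.lineBundleTriv x).inv_hom_id

/-- The retraction is local: the same over any point whose chart carries such a functional. Global form of T-P1VB's `hsplit`:
every point `y` has an open `W ∋ y` and a retraction of `ι|_W`. [folklore] -/
theorem hsplit_of_eval_one (w : ∀ x, Γ(E, c.U x)) (ι : lineBundle c ⟶ E)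
    (hι : ∀ x, (SheafOfModules.overFunctor _ (c.U x)).map ι = c.lineBundleTrivInv x ≫ smulSection (w x))
    (hρ : ∀ x, ∃ ρ : E.over (c.U x) ⟶ (unitModule X).over (c.U x), @Eq Γ(X, c.U x) (appLE ρ (𝟙 (c.U x)) (w x)) 1) (y : X) :
    ∃ (W : X.Opens) (_ : y ∈ W) (r : E.over W ⟶ (lineBundle c).over W), (SheafOfModules.overFunctor _ W).map ι ≫ r = 𝟙 _ := by
  obtain ⟨ρ, hρy⟩ := hρ y
  obtain ⟨r, hr⟩ := exists_retraction_of_eval_one c w ι y (hι y) ρ hρy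
  exact ⟨c.U y, c.mem y, r, hr⟩

/-! ## 4. The functional from unimodular coordinates in a frame -/

/-- **Unimodular coordinates give the functional.** For a frame `e : 𝒪^I ≅ E|_U` (finite `I`), a section `w ∈ Γ(E, U)` and `r : I → Γ(X, U)`
with `Σ_i r_i · coord_i(w) = 1`, the functional `ρ := Σ_i r_i • λ_i` (dual basis) has `ρ(w) = 1`. [cite: Hartshorne1977, II Ex. 5.1] -/
theorem exists_functional_of_unimodular_coords {U : X.Opens} {I : Type u} [Fintype I] (e : SheafOfModules.free I ≅ E.over U)
    (w : Γ(E, U)) (r : I → Γ(X, U)) (hr : ∑ i, r i * coord e (𝟙 U) w i = 1) :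
    ∃ ρ : E.over U ⟶ (unitModule X).over U, @Eq Γ(X, U) (appLE ρ (𝟙 U) w) 1 := by
  refine ⟨∑ i, r i • dualBasis e i, ?_⟩
  rw [← hr, appLE_sum]
  refine Finset.sum_congr rfl fun i _ => ?_
  rw [appLE_smul, structurePresheaf_map_id, coord_def]
  rfl

end Summit.ResolutionOfSingularities.ResolutionOfSingularities.Cruxes.EquisingularLiftNat.P1VB

end
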